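import Literature.NumberTheory.EllipticCurves.GreenbergSelmerNewformDatum
import Literature.NumberTheory.EllipticCurves.CyclotomicPAdicLFunctionWeightK
import Literature.NumberTheory.EllipticCurves.PAdicBSD
import Mathlib.RepresentationTheory.Subrepresentation
import HarnessLib

/-!
# Skinner–Urban 2014, Theorem 1 (= Thm. 3.6.4): the Iwasawa–Greenberg main conjecture for a
# `p`-ordinary newform of weight `k ≡ 2 (mod p − 1)` and trivial character, in `Λ_{𝒪_L} ⊗ ℚ_p`
# (named fact, the GL₂ statement; hypotheses (ord), (irred), (ram) typed verbatim)

C. Skinner, E. Urban, *The Iwasawa main conjectures for `GL₂`*, Invent. Math. 195 (2014), 1–277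
(bib key `SkinnerUrban2014`). Held: the author version `paper:doi-10-1007-s00222-013-0448-1`
(226 pp.), whose three-level numbering (Thm. 3.6.4, …) and page numbers every `[cite:]` of the
tree uses for this source; the journal renumbers §3's statements consecutively (Theorem 1 of the
Introduction is unchanged). HONEST FRAMING (cell `b2b-bsdres`, home
`run/shared/lean/b2b/bsd-rank1-residual/`): Literature = cited statements only; this file TYPES
one published theorem as a named fact (`def … : Prop`, nothing asserted, no `_holds`: its inputs —
Kato's Euler system, the Eisenstein-congruence divisibility on `U(2,2)` of S–U §§4–13, Hida theory
— are not in Mathlib or the tree) in the tree's GL₂ vocabulary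
(`GreenbergSelmer.OrdinaryNewformDatum`, `GreenbergSelmer.DualData`, `IsCycPAdicLFunctionWeightK`;
run/shared/lean/b2b/bsd-rank1-residual/b2b-bsdres-x11a/GL2-VOCAB-SPEC.md), together with two
DEFINITIONS with bodies spelling the residual hypotheses (irred) and "ramified at `q`" for such a
datum, and their unfolding lemmas. The elliptic-curve case (Thm. 3.6.9, p. 45) is the tree's
bsd.S21 `skinner_urban_main_conjecture` (file `PAdicBSD`); Thm. 3.6.11 (a)/(b) are
`padicValRat_bsd_rank_zero` (file `LeadingTerm`) and
`SkinnerUrban2014/SelmerCorankOfVanishingLValueProofs`; the algebra of p. 43 and Lemma 3.1.7 are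
proved in `PAdicBSDSkinnerUrbanSkeletonProofs` and `SkinnerUrban2014/FittingIdealLemma`.

## The source, verbatim (held text; page:line locators of `paper:doi-10-1007-s00222-013-0448-1`)

* §1.1, p. 1, l. 8: "Let `p` be an odd prime." p. 1: "`f ∈ S_k(N, χ)` … a weight `k ≥ 2` newform
  of level `N` and Nebentypus `χ` … Suppose `f` is ordinary; that is, `a(p, f)` is a `p`-adic unit …
  Let `L` be any finite extension of `ℚ_p` containing `ℚ(f)` and the roots of
  `x² − a(p,f)x + χ(p)p^{k−1}` … [Amice–Vélu, Vishik, MTT86] have constructed a `p`-adic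
  `L`-function for `f`. This is a power series `𝓛_f ∈ Λ_{ℚ,𝒪_L} := 𝒪_L⟦Γ_ℚ⟧` … with the property
  that if `φ(γ) = ζ(1+p)^m` with `ζ` a primitive `p^{t_φ−1}`th root of unity and `0 ≤ m ≤ k − 2` …
  `𝓛_f(φ) = e(φ) p^{t'_φ(m+1)} m! L(f, χ_φ⁻¹ω^{−m}, m+1) / ((−2πi)^m G(χ_φ⁻¹ω^{−m}) Ω_f^{sgn((−1)^m)})`"
  (the reciprocity map identifies `1 + pℤ_p` with `Γ_ℚ`, "`γ ∈ Γ_ℚ` the topological generator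
  identified with `1 + p`"; Skinner, Pacific J. Math. 283 (2016), §2.4 footnote: the exponent of
  `−2πi` should read `m + 1` — a constant, immaterial below).
* p. 2, ll. 7–27: "`T := T_f(det ρ_f⁻¹)` and `T⁺ := T_f⁺(det ρ_f⁻¹)` … `Sel_{ℚ_∞,L}(f) ⊂
  ker{H¹(ℚ_∞, T ⊗_{ℤ_p} ℚ_p/ℤ_p) → H¹(ℚ_{∞,p}, T/T⁺ ⊗_{ℤ_p} ℚ_p/ℤ_p)}` of classes unramified at all
  finite places not dividing `p` … Its Pontrjagin dual `X_{ℚ_∞,L}(f)` … is a finitely-generated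
  `Λ_{ℚ,𝒪_L}`-module. The characteristic ideal `Ch_{ℚ_∞,L}(f)` … is well-defined in
  `Λ_{ℚ,𝒪_L} ⊗_{ℤ_p} ℚ_p`. **Iwasawa–Greenberg Main Conjecture for `f`.** `Ch_{ℚ_∞}(f) = (𝓛_f)` in
  `Λ_{ℚ,𝒪_L} ⊗_{ℤ_p} ℚ_p`, and furthermore, if `ρ̄_f` is residually irreducible then this equality
  holds in `Λ_{ℚ,𝒪_L}`."
* **Theorem 1 (Theorem 3.6.4)**, p. 2, ll. 34–44: "Suppose • `χ = 1` and `k ≡ 2 mod p − 1`;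
  • the reduction `ρ̄_f` of `ρ_f` modulo the maximal ideal of `𝒪_L` is irreducible; • there exists
  a prime `q ≠ p` such that `q ‖ N` and `ρ̄_f` is ramified at `q`; • `p ∤ N`. Then
  `Ch_{ℚ_∞,L}(f) = (𝓛_f)` in `Λ_{ℚ,𝒪_L} ⊗_{ℤ_p} ℚ_p`. If furthermore • there exists an `𝒪_L`-basis
  of `T_f` with respect to which the image of `ρ_f` contains `SL₂(ℤ_p)`, then the equality holds
  in `Λ_{ℚ,𝒪_L}`; that is, the Iwasawa-Greenberg Main Conjecture for `f` is true."
* Thm. 3.6.4 as printed in the body (p. 43, ll. 7–19) reads "Let `f ∈ S_k(Np^r, χ; L)`, `k ≥ 2` …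
  be a `p`-ordinary cuspidal eigenform. Suppose • `χ = 1` and `k ≡ 2 mod p − 1`; • (irred) and
  (dist) hold for `ρ_f`; • there exists a prime `q ≠ p` such that `q ‖ N_f` and `ρ̄_f` is ramified
  at `q`; • `p ∤ N_f`. Then for any set of primes `Σ`, `Ch^Σ_{ℚ_∞,L}(f) = (𝓛^Σ_f)` in
  `Λ_{ℚ,𝒪_L} ⊗_{ℤ_p} ℚ_p`. If furthermore [the `SL₂(ℤ_p)` condition] then the equality holds in
  `Λ_{ℚ,𝒪_L}`", with (§3.3.4–3.3.5, p. 29) "(irred) the representation `ρ̄_f` is irreducible",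
  "(ord) `a(p, f)` is a unit in `ℤ_p`", "(dist) `ψ_p⁺` and `ψ_p⁻` are distinct modulo the maximal
  ideal of `𝒪_L`" (`ψ_p^±` the characters of `G_p` on `V_f^±`; `V_f⁺` the unramified line with
  `frob_p ↦ a(p,f)`, `I_p` acting on `V_f⁻` by `σ_χ ε^{1−k}`), and (Thm. 3.3.7, p. 30) "For `f` as
  above with `p ∤ N_f`, the dual Selmer groups `X_{ℚ_∞}^Σ(f, ξ)` are torsion `Λ_{ℚ,𝒪_L}`-modules"
  (Kato). Under `χ = 1`, `p ∤ N`, `k ≡ 2 (mod p−1)` the hypothesis (dist) is AUTOMATIC — on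
  inertia the two characters are `1` and `ω^{1−k} = ω⁻¹ ≠ 1` (`p` odd) — which is why Theorem 1 of
  the Introduction (and Thm. 3.6.9) omit it; the statement typed below is Theorem 1.

## The typed statement and its reading (for the referee's C-audit)

TYPED: `p ≥ 3`; `g ∈ S_k(Γ₀(M))` a newform (`IsNewform0`, so `χ = 1`, `N_f = M`), `2 ≤ k`,
`(p − 1) ∣ (k − 2)`, `p ∤ M`; `ι : K_g → ℚ̄_p` with `|ι(a_p(g))|_p = 1` ((ord)); `Δ` an integral
ordinary datum of `(g, ι)` over `𝒪 = 𝒪_{ℚ_p(ιK_g)}` (`OrdinaryNewformDatum`: the lattice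
`T = 𝒪²` with `ρ : Γ_ℚ → GL₂(𝒪)` ATTACHED to `g` — arithmetic-Frobenius characteristic polynomial
`X² − ι(a_ℓ)X + ℓ^{k−1}`, i.e. S–U's `T_f(det ρ_f⁻¹)` (S–U use geometric conventions,
`det ρ_f = χ ε^{1−k}`, p. 29) — with its ordinary filtration and a uniformiser `ϖ`); (irred) =
`IsResiduallyIrreducible Δ` (the reduction `ρ̄ = ρ mod ϖ` on `(𝒪/ϖ)²` has exactly the two trivial
subrepresentations — Mathlib's `Representation.IsIrreducible` unfolded, `𝒪/ϖ` being the residue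
field `𝔽_L`); (ram) = a finite place `v` of `ℚ` with prime `q ≠ p`, `q ‖ M`, and
`IsResiduallyRamifiedAt Δ v` (some inertia element above `v` acts non-trivially through `ρ̄`);
`κ` the cyclotomic `ℤ_p`-extension with topological generator `γ` matching the cyclotomic variable
(`IsCyclotomicVariable p γ`: `γ ↔ 1 + p`, S–U p. 1; the tree's device of bsd.S20/S21 for
identifying `𝒪⟦Γ_ℚ⟧` with `𝒪⟦T⟧`, `T = γ − 1`, compatibly with the analytic variable); `υ` the unit
root; `L ∈ ℚ̄_p⟦T⟧` a BOUNDED power series with the Mazur–Tate–Teitelbaum interpolation property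
of the cyclotomic `p`-adic `L`-function of the stabilisation of `g` for a period–symbol datum
`Dσ` (`IsCycPAdicLFunctionWeightK`; boundedness makes `L` unique — an unbounded interpolant such as
`L + log(1+T)` satisfies the same interpolation identities — and S–U's `𝓛_f ∈ Λ_{ℚ,𝒪_L}` is
bounded); `D` a Pontryagin-dual datum of Greenberg's `Sel(ℚ_∞, A_f)` (`GreenbergSelmer.DualData`,
`Λ_𝒪 = 𝒪⟦T⟧`). CONCLUSION: `X = D.X` is `Λ_𝒪`-torsion (Thm. 3.3.7) and there are a generator
`G ∈ Λ_𝒪` of `char_{Λ_𝒪} X` and a constant `c ∈ ℚ̄_pˣ` with `G = c · L` coefficientwise in `ℚ̄_p`.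
READING. (i) "`= (𝓛_f)` in `Λ_{𝒪} ⊗ ℚ_p`": the units of `Λ_𝒪[1/p]` are `ϖ^ℤ · Λ_𝒪ˣ`, so the
printed equality says that some generator of `Ch` equals `ϖ^m 𝓛_f`, `m ∈ ℤ`; the tree's `L` is
`c₀ · 𝓛_f` for the non-zero constant `c₀` comparing the period `Dσ.Ω` (symbols `K_g`-rational,
Shimura) with S–U's canonical period `Ω_f⁺` (and absorbing the `(−2πi)` convention), whence
`G = c · L` with `c = ϖ^m c₀⁻¹ ≠ 0`; allowing any `c ∈ ℚ̄_pˣ` makes the typed conclusion WEAKER than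
print, never stronger. Principality of `char` in `Λ_𝒪` itself (not only after `⊗ ℚ_p`) is
harmless: `Λ_𝒪 = 𝒪⟦T⟧` is factorial, and the tree's `Module.charIdeal` is a product of height-one
primes. (ii) `Sel_{ℚ_∞,L}(f)` vs the tree's `Δ.selmer κ = greenbergSelmer` (EPW §3.1: local
condition ZERO at `w ∤ p`, INERTIA at `w ∣ p`): S–U impose "unramified" at `w ∤ p` and the
DECOMPOSITION group at `w ∣ p`; over `ℚ_∞` both pairs of conditions coincide — at `w ∤ p` because
`Gal(ℚ_w^{unr}/ℚ_{∞,w})` is pro-prime-to-`p` (Greenberg, LNM 1716, §2), at `w ∣ p` because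
`ker(H¹(D_w, A″) → H¹(I_w, A″)) = A″/(υ − 1)A″ = 0`, `A″ = (K/𝒪)(φ)` being divisible with
`φ(frob_p) = υ ≠ 1` (`υ = 1` would force `a_p = 1 + p^{k−1} > 2p^{(k−1)/2}`, against Deligne) —
flag `SU14-Sel-Dp-vs-Ip` for the referee; and `T ⊗_{ℤ_p} ℚ_p/ℤ_p = T ⊗_𝒪 K/𝒪 = Cofree ρ K`.
(iii) `Σ = ∅` only; `L = ℚ_p(ιK_g)` (it contains `υ` by Hensel); the INTEGRAL clause (equality in
`Λ_{𝒪}` under the `SL₂(ℤ_p)`-image hypothesis — by Skinner 2016, §2.5, already under (irred)+(ram))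
is NOT typed: it is sensitive to the period, and the tree has no "canonical period" for weight
`k > 2` (`PeriodSymbolDatum` fixes `Ω` up to `K_g^×` only).
`-- TODO(general form): Σ-imprimitive version (any finite Σ); the integral refinement (canonical`
`-- periods Ω_f^± of S–U §3.3.3 / Vatsal 1999); nebentypus χ = ω^{k−2}χ₁ (Cor. 3.6.2–3.6.3);`
`-- the three-variable and K_∞ main conjectures Thms. 3.6.1, 3.6.5, 3.6.6 (no Hida-family /`
`-- U(2,2) vocabulary in the tree).`
Flags proposed for the referee: `SU14-Thm1-rational-only`, `SU14-Sel-Dp-vs-Ip`,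
`SU14-period-constant-c` (conclusion up to `c ∈ ℚ̄_pˣ`); ruled flags carried below:
`SU14-12.3.6-mu@nonsplit` (cell referee R146.6, 2026-08-21, informational — labels unchanged) and,
since the cell referee's ruling R152.2 (2026-08-21), its SPLIT at the prime `3`:
`SU14-12.3.6-mu@nonsplit@3`, graded ACTIVE-PRINT-GAP (see the last paragraph of the next section).

## Printed caveats on the PROOF (refereed print; the statement as printed is unchanged)

Where the step sits (author version). Theorem 1 = Thm. 3.6.4 ⇐ Cor. 3.6.3 ⇐ Thm. 3.6.1 (p. 41),
whose proof invokes **Prop. 12.3.6** (p. 202) twice: §7.4, p. 108, l. 31 ("by Proposition 12.3.6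
`ord_P(𝓛^Σ_1) = 0` if `ord_P(𝓛^Σ_{𝐟,K}) > 0`") and Prop. 13.4.1 (ii), p. 218, l. 5 ("Part (ii)
follows from part (i) and Proposition 12.3.6"). The proof of Prop. 12.3.6, p. 202, ll. 52–55 —
"The hypotheses of the proposition ensure that (12.3.5.a) and (12.3.5.c) hold, so, as noted above,
the `µ`-invariant of `𝓛^{Σ,−}_{f,K,ξ}` is zero" — rests on ¶12.3.5 ("Connections with
anticyclotomic `p`-adic `L`-functions", pp. 201–202; = §12.3.2 of the journal's numbering), namely
on (12.3.5.b), p. 201: `𝓛^{Σ,−}_{f,K,ξ} = L(f, ξ, γ⁻ − 1) · ∏_{ℓ ∈ Σ∖{p}} ∏_{w ∣ ℓ}`(Euler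
factor of `ρ_f ⊗ σ_{ξ⁻}` at `w` on `I_w`-invariants), `L(f, ξ, γ⁻ − 1) ∈ Λ⁻_{K,A}` the
anticyclotomic `p`-adic `L`-function of [PR88]/[BD96] in the notation of [Va03], followed by
p. 202, ll. 7–8: "It follows that the Iwasawa-theoretic `µ`-invariants of the left and right-hand
sides of (12.3.5.b) are the same", and ll. 8–13: under (12.3.5.c) "then by Theorem 1.1 of [Va03]
these `µ`-invariants are zero". S–U, "Remarks on the hypotheses" (ii) after Thm. 3.6.1, p. 41:
"The hypotheses on `N` and `N⁻` and `ρ̄_𝐟|_{I_ℓ}` for `ℓ ∣ N⁻` are needed because of an appeal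
to the work of Vatsal [Va03] (see Proposition 12.3.6)." In the proof of Thm. 3.6.4, p. 43,
ll. 26–27: "Choose an imaginary quadratic field `K` in which `p` splits, all prime divisors of
`N_f/q` split, and `q` is inert (so `N⁻ = q`). Suppose first that `Σ` contains all primes dividing
`pN_f D_K`" — so the primes of `Σ ∖ {p}` that do not split in `K` are the (ram) prime `q` and the
prime divisors of `D_K`.
Two refereed texts print a caveat on this step (no erratum by the authors located, 2026-08-21):
* X. Wan, Forum Math. Sigma 3 (2015) e18 (held text `paper:wan2015-iwasawa-main-conjecture-`
  `hilbert-modular-forms`), p. 4, ll. 19–24: "In fact there is a small mistake in [44, 12.3.2],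
  where they claimed that the `µ`-invariant for the `Σ`-imprimitive `p`-adic `L`-function is `0`
  from the same property for the original `L`-function. However at nonsplit primes the local
  Euler factors do contribute nontrivially to the `µ`-invariant (split primes are OK). So it is
  necessary to compare to Hida's construction in [15] for the argument, and in our paper we are
  only able to make such comparison along the 'parallel weight' Hida family" ([44] = this paper,
  Invent. Math. 195); p. 70, ll. 33–36: "The local Euler factors at `Σ∖{v∣p}` for split primes
  `v` do not affect the anticyclotomic `µ`-invariant (see [44, 12.3.2]). However the Euler factors
  at nonsplit primes are nonzero elements of `𝕀⟦Γ⁺⟧`." The repair printed there: Lemma 87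
  (p. 71: for `P` a height-one prime pulled back from `𝕀⟦Γ⁺⟧`,
  `ord_P 𝓛^Σ_{𝐟,K,1} ≤ ord_P ∏_{nonsplit v ∈ Σ∖{v∣p}} E_{𝐟,K,1,v}`; "The proof follows from our
  Remark 83 and Theorem 86") together with the Poitou–Tate paragraph of the proof of Thm. 101
  (p. 89: the same local Euler factors divide the `Σ`-imprimitive characteristic ideal, by
  [Greenberg–Vatsal 2000, Prop. 2.4]). Thm. 101 (p. 88, l. 30), Thm. 86 (p. 70, l. 5 — Hung's
  non-vanishing theorem; its proof, ll. 17–21: "since `p` is unramified in `F` the only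
  possibility is `p = 3`, which contradicts our assumption") and Thm. 103 (p. 91, l. 42; = the
  journal's Thm. 3.29, i.e. Thm. 3.6.4, in `Λ_{ℚ,𝒪_L} ⊗ ℚ_p`, "without one of the technical local
  assumptions (namely the existence of an `ℓ ∥ M` with `ρ̄|_{G_{ℚ_ℓ}}` ramified)", p. 91,
  ll. 39–41) each begin "Suppose that `p ≥ 5`". [Wan2015HilbertIMC] [Hung2017JNT]
* C. Skinner, Pacific J. Math. 283 (2016), §2.5 (held text `paper:arxiv-1407.1093`, p0011,
  ll. 48–51): "We also take this opportunity to note that the reference to [Vatsal] in the proof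
  of [SU-MCGL] is not sufficient. It may be that the weight two specialization of the Hida family
  in loc. cit. that has trivial character also has multiplicative reduction at `p`. This case is
  excluded in [Vatsal], though the ideas in that paper can be extended to this case, as is
  explained in [Chida-Hsieh]. The reference to [Vatsal] must be augmented by a reference to
  [Chida-Hsieh]." [Skinner2016PacificMC] [ChidaHsieh2018Crelle]
Currency (announced preprint, not a theorem of the tree): Burungale–Skinner–Tian–Wan,
arXiv:2409.01350v2, Thm. 9.21 (c) records the equality `ξ(H¹/Λ·z_γ(g)) = ξ(X_st(g))` for "`p ∤ 6N`
an ordinary prime such that (irr_ℚ) holds … an equality in `Λ_{𝒪_λ}` for primes `p ∤ 2N` if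
(ram) holds", attributing the integral equality to [SU] and the rational one to Wan; in the same
proof, for the quadratic twist `g_K`: "instead of resorting to the vanishing of the anticyclotomic
`µ`-invariant [Va] in [SU], we utilise a non-vanishing result of Hung [Hu] (see also [CLW]). The
latter does not explicitly cover our setting, however the same argument applies".
[BurungaleSkinnerTianWan2024]
The elliptic-curve case bsd.S21 `skinner_urban_main_conjecture` (Thm. 3.6.9, file `PAdicBSD`) and
the Thm. 2 / Thm. 3.6.11 consumers rest on the same step. Which pairs `(E, p)` the caveat
concerns, and at which `p` the printed repair applies, is a READING kept outside the tree
(run/shared/lean/b2b/bsd-rank1-residual/b2b-bsdres-lit-su/SU2014-TYPING.md §25); nothing in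
this file asserts the theorem (it is a `Prop`, no `_holds`).

The prime `p = 3` (cell referee ruling R152.2, 2026-08-21, on the reading SU2014-TYPING.md
§25.3 (I1)–(I3) / §26, which the referee re-read on pp. 43 and 201–202 of the author version and
on the pages of Wan cited above). What the ruling records: in the proof of Thm. 3.6.4 the (ram)
prime `q` is chosen inert in `K` with `q ∈ Σ` (p. 43, ll. 23–27); the `w ∣ q` factor of (12.3.5.b)
is then a constant, `1 − a_q(f)² q⁻² = (q² − 1)/q²` in weight two (`q ∥ N_f`; Frobenius at the
inert place `w` acts trivially on `Γ⁻_K`), and `3 ∣ q² − 1` for every prime `q ≠ 3` — so at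
`p = 3` that factor is never a `p`-adic unit and the sentence p. 202, ll. 54–55 ("the `µ`-invariant
of `𝓛^{Σ,−}_{f,K,ξ}` is zero") cannot be obtained from [Va03] as printed in any instance of the
Thm. 3.6.4 argument, whereas for `p ≥ 5` a (ram) prime `q ≢ ±1 (mod p)` may be available and,
where it is not, the refereed repair of [Wan2015HilbertIMC] (Lemma 87, Thm. 101, Thm. 103 — each
under "`p ≥ 5`"; the proof of Thm. 86 excludes `p = 3` at p. 70, ll. 17–21) applies. No refereed
repair at `p = 3` has been located (2026-08-21: no erratum by the authors in Crossref;
Burungale–Castella–Skinner, IMRN 2025, assumes "`p > 3`" throughout; [BurungaleSkinnerTianWan2024]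
Thm. 9.21 (c) cites [SU] at `p ∤ 2N` under (ram), and its Thm. 10.10 (a) announces a non-[SU]
zeta-element road at ordinary `p ∤ 2N` only for `N` square-free (Rem. 10.11) — an announced
preprint). Accordingly the cell
referee SPLIT the flag: `SU14-12.3.6-mu@nonsplit` stays informational at `p ≥ 5`, and
`SU14-12.3.6-mu@nonsplit@3` is graded ACTIVE-PRINT-GAP — "the only printed proof has a
refereed-acknowledged gap that is active in every `p = 3` instance; no refereed repair located at
`p = 3`; repair announced only" — on this statement, on bsd.S21 / Thm. 2 / Thm. 3.6.11 and on the
Skinner 2016 Thm. C consumers ("The main results of [SU-MCGL] show …"), AT `p = 3` ONLY. This is a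
record about the state of the printed PROOF: the theorems remain refereed theorems in print, no
contrary instance is suggested and none is asserted here, and the statement typed below is unchanged;
the further remark that Prop. 12.3.6 as stated sits uneasily at `p = 3` with Thm. 3.6.6 and the
`Σ`-change relation (SU2014-TYPING.md §26.3 (S2)) is an INFERENCE kept outside the tree. A
refereed `p = 3` repair (a journal version of [BurungaleSkinnerTianWan2024], an erratum, or an
`F = ℚ` analogue of Wan's Lemma 87 without "`p ≥ 5`") retires the `@3` flag.

## References

* C. Skinner, E. Urban, Invent. Math. 195 (2014): §1.1 and Thm. 1 (pp. 1–2), §3.1.3 (p. 18),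
  §3.1.6 (pp. 19–20), §3.3.4–3.3.7 (pp. 29–30), §3.4.4 (p. 38), Conj. 3.5.5 and Thm. 3.5.6 (p. 41),
  Thm. 3.6.4 with its proof and "Remarks on the hypotheses" (p. 43). [SkinnerUrban2014]
* C. Skinner, E. Urban, ibid.: Thm. 3.6.1 and "Remarks on the hypotheses" (ii) (p. 41), §7.4
  (p. 108), Thm. 12.3.1–Prop. 12.3.6 (pp. 199–202), Prop. 13.4.1 (pp. 217–218) — located for the
  printed caveats above. [SkinnerUrban2014]
* C. Skinner, Pacific J. Math. 283 (2016), §2.4 (footnote on `(−2πi)^{m+1}`), §2.5 (Thm. 9 and the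
  remark that (ii)+(iii) suffice for the integral equality; the [Vatsal]/[Chida-Hsieh] remark).
  [Skinner2016PacificMC]
* X. Wan, Forum Math. Sigma 3 (2015), e18: p. 4, p. 70, Lemma 87 (p. 71), Thm. 86 (p. 70),
  Thm. 101 (pp. 88–89), Thm. 103 (pp. 91–92). [Wan2015HilbertIMC]
* M. Chida, M.-L. Hsieh, J. reine angew. Math. 741 (2018), 87–131. [ChidaHsieh2018Crelle]
* P.-C. Hung, J. Number Theory 173 (2017), 170–209 (= Wan's [26]). [Hung2017JNT]
* A. Burungale, C. Skinner, Y. Tian, X. Wan, arXiv:2409.01350v2 (announced), Thm. 9.21 and its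
  proof; Thm. 10.10 (a) with Rem. 10.11. [BurungaleSkinnerTianWan2024]
* M. Emerton, R. Pollack, T. Weston, Invent. Math. 163 (2006), §3.1. [EmertonPollackWeston2006]
* R. Greenberg, LNM 1716 (1999), §2 (local conditions over `ℚ_∞`). [GreenbergLNM1716]
* K. Kato, Astérisque 295 (2004), Thm. 17.4. [Kato2004Asterisque]
-/

noncomputable section

open scoped Classical MatrixGroups ModularForm NumberField

open CongruenceSubgroup UpperHalfPlane IsDedekindDomain Field
  Literature.NumberTheory.GaloisRepresentations
  Literature.NumberTheory.EllipticCurves.ModularForms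
  Literature.NumberTheory.EllipticCurves.GreenbergSelmer

namespace Literature.NumberTheory.EllipticCurves.SkinnerUrban2014

variable {M : ℕ} {k : ℤ} {g : CuspForm (Gamma0 M) k} {p : ℕ} [Fact p.Prime]
  {ι : coeffField g →+* PadicAlgCl p}

/-! ### The residual representation of an integral ordinary datum and the hypotheses (irred), (ram) -/

/-- **The reduction `ρ̄ = ρ mod ϖ`** of the integral model `ρ : Γ_ℚ → GL₂(𝒪)` of an integral
ordinary datum `Δ` of `(g, ι)`: the representation of `Γ_ℚ` on `(𝒪/ϖ)² = T/ϖT` obtained by base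
change along `𝒪 → 𝒪/(ϖ)` (`𝒪/(ϖ) = 𝔽_L`, the residue field, `ϖ` being a uniformiser). S–U
§3.3.4 (p. 29): "`T̄_f := T_f ⊗_{𝒪_L} 𝔽_L` … we denote the corresponding homomorphism
`G_ℚ → GL_{𝔽_L}(T̄_f)` by `ρ̄_f`." [cite: SkinnerUrban2014, §3.3.4 (p. 29)] -/
def residualRep (Δ : OrdinaryNewformDatum g p ι) :
    Representation (padicCoeffIntegers ι ⧸ Ideal.span {Δ.ϖ}) (absoluteGaloisGroup ℚ)
      (Fin 2 → padicCoeffIntegers ι ⧸ Ideal.span {Δ.ϖ}) :=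
  FramedRep.baseChangeRepresentation (Ideal.Quotient.mk (Ideal.span {Δ.ϖ})) Δ.ρ

/-- Unfolding `residualRep`: it is the base change of `Δ.ρ` along `𝒪 → 𝒪/(ϖ)`.
[cite: SkinnerUrban2014, §3.3.4 (p. 29)] -/
theorem residualRep_def (Δ : OrdinaryNewformDatum g p ι) :
    residualRep Δ =
      FramedRep.baseChangeRepresentation (Ideal.Quotient.mk (Ideal.span {Δ.ϖ})) Δ.ρ :=
  rfl

/-- **(irred)** for the datum `Δ` (S–U §3.3.4, p. 29: "(irred) the representation `ρ̄_f` is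
irreducible"; p. 2: "the reduction `ρ̄_f` of `ρ_f` modulo the maximal ideal of `𝒪_L` is
irreducible"): the reduction `ρ̄` on `(𝒪/ϖ)²` has exactly two subrepresentations, `0` and the
whole space — Mathlib's `Representation.IsIrreducible := IsSimpleOrder (Subrepresentation ρ)`,
written out because Mathlib states that abbreviation over a `Field` instance, while `𝒪/(ϖ)` is
the residue field presented as a quotient ring. (S–U, loc. cit.: "When this is the case for one
choice of `T_f` then it is true for all choices of `T_f`.") [cite: SkinnerUrban2014, §3.3.4 (p. 29), (irred)] -/
def IsResiduallyIrreducible (Δ : OrdinaryNewformDatum g p ι) : Prop :=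
  IsSimpleOrder (Subrepresentation (residualRep Δ))

/-- Unfolding `IsResiduallyIrreducible`. [cite: SkinnerUrban2014, §3.3.4 (p. 29), (irred)] -/
theorem isResiduallyIrreducible_iff (Δ : OrdinaryNewformDatum g p ι) :
    IsResiduallyIrreducible Δ ↔ IsSimpleOrder (Subrepresentation (residualRep Δ)) :=
  Iff.rfl

/-- **"`ρ̄_f` is ramified at `q`"** for the datum `Δ` at the finite place `v` of `ℚ` (S–U Thm. 1,
p. 2, third bullet): NOT every inertia group `I_𝔓 ≤ Γ_ℚ`, `𝔓` a prime of `ℤ̄` above `v`, acts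
trivially through the reduction `ρ̄` — the negation, for `ρ̄`, of the tree's
`FramedGaloisRep.IsUnramifiedAt` ("every `I_𝔓`, `𝔓 ∣ v`, maps to `1`").
[cite: SkinnerUrban2014, Thm. 1 (p. 2), hypothesis "ρ̄_f is ramified at q"] -/
def IsResiduallyRamifiedAt (Δ : OrdinaryNewformDatum g p ι) (v : HeightOneSpectrum (𝓞 ℚ)) : Prop :=
  ¬ ∀ 𝔓 ∈ v.primesAbove, ∀ σ ∈ 𝔓.inertia (absoluteGaloisGroup ℚ), residualRep Δ σ = 1

/-- Unfolding `IsResiduallyRamifiedAt`: some inertia element above `v` acts non-trivially through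
`ρ̄`. [cite: SkinnerUrban2014, Thm. 1 (p. 2)] -/
theorem isResiduallyRamifiedAt_iff (Δ : OrdinaryNewformDatum g p ι) (v : HeightOneSpectrum (𝓞 ℚ)) :
    IsResiduallyRamifiedAt Δ v ↔
      ∃ 𝔓 ∈ v.primesAbove, ∃ σ ∈ 𝔓.inertia (absoluteGaloisGroup ℚ), residualRep Δ σ ≠ 1 := by
  simp only [IsResiduallyRamifiedAt, not_forall, exists_prop]

/-! ### Theorem 1 (= Thm. 3.6.4), rational form, as a named fact -/

/-- **Skinner–Urban 2014, Theorem 1 (= Thm. 3.6.4): for a `p`-ordinary newform `f` of weight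
`k ≡ 2 (mod p − 1)` and trivial character the characteristic ideal of the dual Selmer group of
`f` over `ℚ_∞` is generated by the `p`-adic `L`-function `𝓛_f`, in `Λ_{𝒪_L} ⊗ ℚ_p`** (a THEOREM
of the source, proved there from Kato's divisibility and the Eisenstein-congruence divisibility
Thm. 3.6.1). VERBATIM (p. 2): "Suppose • `χ = 1` and
`k ≡ 2 mod p − 1`; • the reduction `ρ̄_f` of `ρ_f` modulo the maximal ideal of `𝒪_L` is
irreducible; • there exists a prime `q ≠ p` such that `q ‖ N` and `ρ̄_f` is ramified at `q`;
• `p ∤ N`. Then `Ch_{ℚ_∞,L}(f) = (𝓛_f)` in `Λ_{ℚ,𝒪_L} ⊗_{ℤ_p} ℚ_p`" [integral refinement under an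
`SL₂(ℤ_p)`-image hypothesis not typed], `p` an odd prime (§1.1), `f ∈ S_k(N)` a `p`-ordinary
newform, `k ≥ 2`, `X_{ℚ_∞,L}(f)` torsion (Thm. 3.3.7, Kato). TYPED (module docstring, "The typed
statement and its reading", for every identification): for `p ≥ 3`, a newform `g ∈ S_k(Γ₀(M))`,
`2 ≤ k`, `(p−1) ∣ (k−2)`, `p ∤ M`, an embedding `ι : K_g → ℚ̄_p` with `|ι(a_p(g))|_p = 1`, an
integral ordinary datum `Δ` of `(g, ι)` with (irred) `IsResiduallyIrreducible Δ` and (ram) at some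
place `v` of residue characteristic `q ≠ p`, `q ‖ M`; the cyclotomic `ℤ_p`-extension `κ` with
topological generator `γ` matching the cyclotomic variable; the unit root `υ`; a BOUNDED `L ∈ ℚ̄_p⟦T⟧`
with the interpolation property `IsCycPAdicLFunctionWeightK g Dσ p ι υ L` for a period–symbol
datum `Dσ`; and any dual datum `D` of `Sel(ℚ_∞, A_f)` over `Λ_𝒪 = 𝒪⟦T⟧`: THEN `D.X` is
`Λ_𝒪`-torsion and `char_{Λ_𝒪}(D.X) = (G)` with `G = c · L` in `ℚ̄_p⟦T⟧` for some constant `c ≠ 0`.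
Named fact; nothing asserted; no `_holds`. Flags: `SU14-Thm1-rational-only`, `SU14-Sel-Dp-vs-Ip`,
`SU14-period-constant-c`.
-- TODO(general form): see the module docstring (Σ, integral clause, χ ≠ 1, Thms. 3.6.1/3.6.5/3.6.6).
[cite: SkinnerUrban2014, Thm. 1 (p. 2) = Thm. 3.6.4 (p. 43); §3.3.4–3.3.7 (pp. 29–30); §3.4.4 (p. 38)] -/
def thm1_charIdeal_eq_padicLFunction_rational : Prop :=
  ∀ (p : ℕ) [Fact p.Prime], 3 ≤ p →
  ∀ {M : ℕ} [NeZero M] {k : ℤ} (g : CuspForm (Gamma0 M) k) (ι : coeffField g →+* PadicAlgCl p),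
    IsNewform0 g → 2 ≤ k → ((p : ℤ) - 1) ∣ (k - 2) → ¬ p ∣ M →
    ‖ι ⟨(qExpansion 1 ⇑g).coeff p, coeff_mem_coeffField g p⟩‖ = 1 →
  ∀ (Δ : OrdinaryNewformDatum g p ι), IsResiduallyIrreducible Δ →
    (∃ v : HeightOneSpectrum (𝓞 ℚ),
      ((Rat.HeightOneSpectrum.primesEquiv v : Nat.Primes) : ℕ) ≠ p ∧
      ((Rat.HeightOneSpectrum.primesEquiv v : Nat.Primes) : ℕ) ∣ M ∧
      ¬ ((Rat.HeightOneSpectrum.primesEquiv v : Nat.Primes) : ℕ) ^ 2 ∣ M ∧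
      IsResiduallyRamifiedAt Δ v) →
  ∀ (κ : ZpExtension ℚ p) (γ : absoluteGaloisGroup ℚ), κ.IsCyclotomic → κ.IsTopGenerator γ →
    IsCyclotomicVariable p γ →
  ∀ (υ : PadicAlgCl p) (Dσ : PeriodSymbolDatum g) (L : PowerSeries (PadicAlgCl p)),
    υ ^ 2 - ι ⟨(qExpansion 1 ⇑g).coeff p, coeff_mem_coeffField g p⟩ * υ
        + (p : PadicAlgCl p) ^ (k - 1).toNat = 0 →
    ‖υ‖ = 1 → IsCycPAdicLFunctionWeightK g Dσ p ι υ L →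
    (∃ C : ℝ, ∀ i, ‖PowerSeries.coeff i L‖ ≤ C) →
  ∀ (D : DualData (padicCoeffField ι) κ γ Δ.ρ Δ.plus),
    Module.IsTorsion (PowerSeries (padicCoeffIntegers ι)) D.X ∧
    ∃ (G : PowerSeries (padicCoeffIntegers ι)) (c : PadicAlgCl p), c ≠ 0 ∧
      D.charIdeal = Ideal.span {G} ∧
      G.map (padicCoeffIntegers.toPadicAlgCl ι) = PowerSeries.C c * L

end Literature.NumberTheory.EllipticCurves.SkinnerUrban2014

end
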